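import Literature.MathematicalPhysics.QuantumLattice.MPSCoarseGrainingBounds
import HarnessLib

/-!
# The MPS transfer matrix and the coarse-graining map: `‖W_k W_kᴴ‖_F = ‖T^k‖_F`

For an MPS tensor `A = (A^s)_s`, `A^s ∈ M_D(ℂ)`, the TRANSFER MATRIX is `T = Σ_s A^s ⊗ conj(A^s) ∈ M_{D²}(ℂ)`
(Perez-Garcia–Verstraete–Wolf–Cirac §3.2.2: the completely positive map `𝓔(X) = Σ_i A_i X A_i†` and `E_𝟙 = Σ_i A_i ⊗ Ā_i` have the same spectrum). Its powers collect the
words: `(T^k)_{(a,a'),(b,b')} = Σ_t (A^{t₁}⋯A^{t_k})_{ab} · conj (A^{t₁}⋯A^{t_k})_{a'b'}`, which is the REALIGNMENT of the Gram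
matrix `W_k W_kᴴ` of KSDN's coarse-graining map `W_k` (`(W_k)_{(a,b),t} = (A^{t₁}⋯A^{t_k})_{ab}`, `MPSCoarseGrainingMaps.cgMap`):
`(W_k W_kᴴ)_{(a,b),(a',b')} = (T^k)_{(a,a'),(b,b')}`. Consequently `‖W_k W_kᴴ‖_F = ‖T^k‖_F`, so the a-priori bound of
`MPSCoarseGrainingBounds` reads `|C_k(ρ)_{ij}| ≤ ‖T^k‖_F` — a number computable from `A` by `k` products of `D² × D²`
matrices (the constant `B_{k+2}` of sr-mbsolver's `FORMAT-ltisdp.md` §2 (c)). No `sorry`, no new axiom, no named fact.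
[cite: KullEtAl2024, §2.3–2.5] [cite: PerezGarciaVerstraeteWolfCirac2007, §3.2.2 (`𝓔(X) = Σ_i A_i X A_i†`, `E_𝟙 = Σ_i A_i ⊗ Ā_i`)]
-/

noncomputable section

namespace Literature.MathematicalPhysics.QuantumLattice

open Matrix Finset
open scoped ComplexOrder BigOperators Kronecker

namespace MPSCoarseGraining

variable {σ β : Type*} [Fintype σ] [Fintype β] [DecidableEq β]

/-- **The MPS transfer matrix** `T = Σ_s A^s ⊗ conj(A^s)`: `T_{(a,a'),(c,c')} = Σ_s A^s_{ac} conj(A^s_{a'c'})`.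
[cite: PerezGarciaVerstraeteWolfCirac2007, §3.2.2] [cite: KullEtAl2024, §2.5] -/
def transferOp (A : σ → Matrix β β ℂ) : Matrix (β × β) (β × β) ℂ :=
  ∑ s, A s ⊗ₖ (A s).map (starRingEnd ℂ)

omit [Fintype β] [DecidableEq β] in
/-- Entries of `T`. [cite: PerezGarciaVerstraeteWolfCirac2007, §3.2.2] -/
theorem transferOp_apply (A : σ → Matrix β β ℂ) (a a' c c' : β) :
    transferOp A (a, a') (c, c') = ∑ s, A s a c * star (A s a' c') := by
  rw [transferOp, Matrix.sum_apply]
  refine Finset.sum_congr rfl fun s _ => ?_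
  rw [Matrix.kroneckerMap_apply, Matrix.map_apply, RCLike.star_def]

/-- **Powers of the transfer matrix collect the words**:
`(T^k)_{(a,a'),(b,b')} = Σ_t (A^{t₁}⋯A^{t_k})_{ab} conj (A^{t₁}⋯A^{t_k})_{a'b'}`. [cite: PerezGarciaVerstraeteWolfCirac2007, §3.2.2] [cite: KullEtAl2024, §2.5] -/
theorem transferOp_pow_apply (A : σ → Matrix β β ℂ) (k : ℕ) (a a' b b' : β) :
    (transferOp A ^ k) (a, a') (b, b') = ∑ t : Fin k → σ, word A t a b * star (word A t a' b') := by
  induction k generalizing b b' with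
  | zero =>
    rw [pow_zero, Matrix.one_apply]
    simp only [Finset.univ_unique, Finset.sum_singleton, word_zero, Matrix.one_apply, Prod.mk.injEq]
    by_cases hab : a = b <;> by_cases hab' : a' = b' <;> simp [hab, hab']
  | succ k ih =>
    -- the words of length `k+1` as (last letter, prefix)
    have hR : ∑ t : Fin (k + 1) → σ, word A t a b * star (word A t a' b') =
        ∑ s : σ, ∑ t : Fin k → σ, (word A t * A s) a b * star ((word A t * A s) a' b') := by
      rw [← (Fin.snocEquiv fun _ => σ).sum_comp (fun t : Fin (k + 1) → σ => word A t a b * star (word A t a' b')),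
        Fintype.sum_prod_type]
      refine Finset.sum_congr rfl fun s _ => Finset.sum_congr rfl fun t _ => ?_
      rw [show (Fin.snocEquiv fun _ => σ) (s, t) = (Fin.snoc t s : Fin (k + 1) → σ) from rfl, word_snoc]
    -- the entries of `T^k · T`
    have hL : ∀ p : β × β, (transferOp A ^ k) (a, a') p * transferOp A p (b, b') =
        ∑ s : σ, ∑ t : Fin k → σ, (word A t a p.1 * A s p.1 b) * star (word A t a' p.2 * A s p.2 b') := by
      rintro ⟨c, c'⟩
      rw [ih, transferOp_apply, Finset.sum_mul_sum, Finset.sum_comm]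
      refine Finset.sum_congr rfl fun s _ => Finset.sum_congr rfl fun t _ => ?_
      rw [star_mul]
      ring
    rw [hR, pow_succ, Matrix.mul_apply]
    simp_rw [hL]
    rw [Finset.sum_comm]
    refine Finset.sum_congr rfl fun s _ => ?_
    rw [Finset.sum_comm]
    refine Finset.sum_congr rfl fun t _ => ?_
    rw [Matrix.mul_apply, Matrix.mul_apply, star_sum, Finset.sum_mul_sum, Fintype.sum_prod_type]

/-- **The Gram matrix of the coarse-graining map is the realigned transfer power**:
`(W_k W_kᴴ)_{(a,b),(a',b')} = (T^k)_{(a,a'),(b,b')}`. [cite: KullEtAl2024, §2.5] [cite: PerezGarciaVerstraeteWolfCirac2007, §3.2.2] -/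
theorem cgMap_mul_conjTranspose_apply (A : σ → Matrix β β ℂ) (k : ℕ) (a b a' b' : β) :
    (cgMap A k * (cgMap A k)ᴴ) (a, b) (a', b') = (transferOp A ^ k) (a, a') (b, b') := by
  rw [transferOp_pow_apply, Matrix.mul_apply]
  refine Finset.sum_congr rfl fun t _ => ?_
  rw [Matrix.conjTranspose_apply, cgMap_apply, cgMap_apply]

/-- **`‖W_k W_kᴴ‖_F² = ‖T^k‖_F²`** (a realignment is a Frobenius isometry). [cite: KullEtAl2024, §2.5] -/
theorem frobSq_cgMap_mul_conjTranspose (A : σ → Matrix β β ℂ) (k : ℕ) :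
    frobSq (cgMap A k * (cgMap A k)ᴴ) = frobSq (transferOp A ^ k) := by
  rw [frobSq, frobSq, Fintype.sum_prod_type, Fintype.sum_prod_type]
  simp_rw [Fintype.sum_prod_type, cgMap_mul_conjTranspose_apply]
  -- `Σ_a Σ_b Σ_{a'} Σ_{b'} f (a,a') (b,b') = Σ_a Σ_{a'} Σ_b Σ_{b'} f (a,a') (b,b')`
  refine Finset.sum_congr rfl fun a _ => ?_
  rw [Finset.sum_comm]

/-- **The a-priori bound in transfer-matrix form**: `|C_k(ρ)_{ij}| ≤ ‖T^k‖_F` for every density matrix `ρ`, and hence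
`≤ B` for any `B ≥ 0` with `‖T^k‖_F² ≤ B²` (a rational check on the certificate's constant). [cite: KullEtAl2024, §2.3–2.5] -/
theorem norm_cgState_apply_le_of_transferOp {q : ℕ} (A : Fin q → Matrix β β ℂ) (k : ℕ) {ρ : Op (Fin (k + 2)) q}
    (hρ : ρ.PosSemidef) (htr : ρ.trace = 1) {B : ℝ} (hB0 : 0 ≤ B) (hB : frobSq (transferOp A ^ k) ≤ B ^ 2)
    (i j : Fin q × ((β × β) × Fin q)) : ‖cgState A k ρ i j‖ ≤ B :=
  norm_cgState_apply_le_of_frobSq_le A k hρ htr hB0 (by rwa [frobSq_cgMap_mul_conjTranspose]) i j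

end MPSCoarseGraining

end Literature.MathematicalPhysics.QuantumLattice
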